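import Summits.Ventures.YMGap.RobustBall.HeatBathPoincareZdBallDLR
import HarnessLib

/-!
# Robust ball (Y2) — THE HEAT-BATH POINCARÉ INEQUALITY OF A GIBBS STATE ON ITS NATURAL DOMAIN: closure under uniform approximation
# (quasilocal observables with square-summable link oscillations)

HONEST FRAMING: venture file of the cell `pub-ymgap` (QuantumFields programme), track ROBUST-BALL, seat rb-p2 (g15); a TOOL on top of
`HeatBathPoincareZdDLR.lean` (g12: the heat-bath Poincaré inequality of EVERY DLR state for Lipschitz CYLINDER observables) and `HeatBathPoincareZdBallDLR.lean`
(g14: the same for every member of the `ℤ^d` ball).  LATTICE statements at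
STRONG COUPLING; «gap» means a Poincaré constant⁻¹ (no dynamics object is constructed); nothing about `β → ∞`, the continuum or Clay.

THE STATEMENT.  ABSTRACT (`gibbs_variance_le_tsum_of_uniformApprox`, any specification `γ` on `ι → S`, any Gibbs state `μ`): suppose the Poincaré
inequality `Var_μ(G) ≤ A ∑_{x ∈ Δ_G} T^μ_x(G)` with the conditional-variance functional `T^μ_x(G) := ∫∫ (G(U) − G(σ))² γ_{x}(dσ|U) μ(dU)` is known for a
sequence of observables `G_n` (finite link sets `Δ_n`), that `G_n → F` UNIFORMLY, and that `F` and all `G_n` have one-link oscillations `≤ δ_x` with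
`∑_x δ_x² < ∞`.  Then `x ↦ T^μ_x(F)` is summable and `Var_μ(F) ≤ A ∑'_x T^μ_x(F)` — the inequality holds on the uniform closure with the `ℓ²`-DIRICHLET SUM over
ALL links (the natural domain of the infinite-volume single-link heat-bath Dirichlet form, cf. Liggett, IPS, Ch. I §3–4 and Stroock–Zegarlinski (1.1)).
Mechanism: `Var_μ(F) ≤ Var_μ(G_n) + O(ε_n)`; `T_x(G_n) ≤ min(δ_x², T_x(F) + 4δ_xε_n + 4ε_n²)` by properness (`siteAvg_eq_integral_siteLaw`); the finite
Dirichlet sum is dominated by the summable `∑' min(…)`, which tends to `∑' T_x(F)` by dominated convergence (`tendsto_tsum_of_dominated_convergence`).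
WILSON CELLS: `gibbsVariance_le_tsum_of_oneLinkKRModulus` (every `SU(N)`, every `d`, KR window `6(d−1)|β|K ≤ c < 1`: for EVERY DLR state and every bounded
measurable `F` that is a uniform limit of Lipschitz cylinders with common square-summable oscillation profile, `Var_μ(F) ≤ (2(1−c))⁻¹ ∑'_x T^μ_x(F)`), and
★ `su2_gibbsVariance_le_tsum` (`SU(2)`, `d = 4`, `0 ≤ β_W < 2/9`: constant `(2 − 9β_W)⁻¹`).  BALL CELLS: `gibbsVariance_le_tsum_onBall` (every member of the
`ℤ^d` ball under the hypotheses of `HeatBathPoincareZd.gibbsVariance_le_onBall`, every DLR state of the member, ONE constant `(2(1−c))⁻¹`) and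
`su2_gibbsVariance_le_tsum_onBall_quarter`.  Typical members of the class: absolutely summable weighted sums
`∑_p w_p W_p` of plaquette (or loop) observables, `∑ |w_p| < ∞`, approximated by their finite truncations.  0 sorry, 0 definitions.
References: T. M. Liggett, Interacting Particle Systems (1985), Ch. I §3–4; D. W. Stroock, B. Zegarlinski, CMP 144 (1992) 303, (1.1); L. Wu, Ann. Probab. 34
(2006) 1960.  Everything here is proved. [folklore]
-/

noncomputable section

open MeasureTheory Function Real Finset ProbabilityTheory Filter Topology
open scoped NNReal
open Literature.Probability.LatticeModels Literature.Probability.LatticeModels.DobrushinMetric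
open Literature.MathematicalPhysics.QuantumLattice hiding torusNorm
open Literature.MathematicalPhysics.QuantumFieldTheory hiding ZdEdge
open Literature.MathematicalPhysics.QuantumFieldTheory.Balaban1983to89.StrongCouplingDobrushinWindow (OneLinkKRModulus)

namespace Summit.Ventures.YMGap.RobustBall.HeatBathPoincareZd

/-! ### Abstract: closure of a Gibbs-state heat-bath Poincaré inequality under uniform approximation -/

section Abstract

variable {ι : Type*} [DecidableEq ι] {S : Type*} [MeasurableSpace S] {γ : Specification ι S}

omit [DecidableEq ι] [MeasurableSpace S] in
/-- Algebra of the approximation steps: `|D| ≤ δ`, `|D' − D| ≤ 2ε` ⇒ `D'² ≤ D² + 4δε + 4ε²`. [folklore] -/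
theorem sq_le_sq_add_of_abs_sub_le {D D' δ ε : ℝ} (hD : |D| ≤ δ) (hr : |D' - D| ≤ 2 * ε) :
    D' ^ 2 ≤ D ^ 2 + (4 * δ * ε + 4 * ε ^ 2) := by
  have hε0 : 0 ≤ 2 * ε := (abs_nonneg _).trans hr
  have hδ0 : 0 ≤ δ := (abs_nonneg _).trans hD
  have e : D' ^ 2 = D ^ 2 + 2 * (D * (D' - D)) + (D' - D) ^ 2 := by ring
  have h1 : D * (D' - D) ≤ δ * (2 * ε) :=
    (le_abs_self _).trans (by rw [abs_mul]; exact mul_le_mul hD hr (abs_nonneg _) hδ0)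
  have h2 : (D' - D) ^ 2 ≤ (2 * ε) ^ 2 := by
    rw [← sq_abs]; exact pow_le_pow_left₀ (abs_nonneg _) hr 2
  rw [e]; nlinarith [h1, h2]

/-- **Kernel step**: if `|G − F| ≤ ε` uniformly and `F` has oscillation `≤ δ` at `x`, then
`∫ (G(η) − G(σ))² γ_{x}(dσ|η) ≤ ∫ (F(η) − F(σ))² γ_{x}(dσ|η) + (4δε + 4ε²)` (properness: under `γ_{x}(·|η)` only the spin at `x` moves). [folklore] -/
theorem integral_sq_sub_le_add_of_approx (hγ : IsSpecification γ) (x : ι) {F G : (ι → S) → ℝ} (hF : Measurable F) (hG : Measurable G)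
    {M ε δ : ℝ} (hM : ∀ U, |F U| ≤ M) (hε : ∀ U, |G U - F U| ≤ ε) (hδ : ∀ U s, |F U - F (update U x s)| ≤ δ) (η : ι → S) :
    ∫ σ, (G η - G σ) ^ 2 ∂(γ {x} η) ≤ ∫ σ, (F η - F σ) ^ 2 ∂(γ {x} η) + (4 * δ * ε + 4 * ε ^ 2) := by
  haveI := isProbabilityMeasure_siteLaw hγ x η
  have hε0 : 0 ≤ ε := (abs_nonneg _).trans (hε η)
  have h1 := siteAvg_eq_integral_siteLaw hγ x (f := fun σ => (G η - G σ) ^ 2) ((measurable_const.sub hG).pow_const 2) η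
  have h2 := siteAvg_eq_integral_siteLaw hγ x (f := fun σ => (F η - F σ) ^ 2) ((measurable_const.sub hF).pow_const 2) η
  unfold siteAvg at h1 h2
  beta_reduce at h1 h2
  rw [h1, h2]
  -- pointwise comparison of the integrands on the single-site law
  have hpt : ∀ s, (G η - G (update η x s)) ^ 2 ≤ (F η - F (update η x s)) ^ 2 + (4 * δ * ε + 4 * ε ^ 2) := fun s => by
    have hD : |F η - F (update η x s)| ≤ δ := hδ η s
    have hdiff : |(G η - G (update η x s)) - (F η - F (update η x s))| ≤ 2 * ε := by
      have e : (G η - G (update η x s)) - (F η - F (update η x s)) = (G η - F η) - (G (update η x s) - F (update η x s)) := by ring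
      rw [e]
      exact (abs_sub _ _).trans (by linarith [hε η, hε (update η x s)])
    exact sq_le_sq_add_of_abs_sub_le hD hdiff
  -- integrate: the right-hand integrand is bounded and measurable
  have hFb2 : ∀ s, |(F η - F (update η x s)) ^ 2 + (4 * δ * ε + 4 * ε ^ 2)| ≤ (2 * M) ^ 2 + (4 * |δ| * ε + 4 * ε ^ 2) := fun s => by
    have hb : |F η - F (update η x s)| ≤ 2 * M := (abs_sub _ _).trans (by linarith [hM η, hM (update η x s)])
    have hsq : (F η - F (update η x s)) ^ 2 ≤ (2 * M) ^ 2 := by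
      rw [← sq_abs]; exact pow_le_pow_left₀ (abs_nonneg _) hb 2
    rw [abs_le]; constructor
    · nlinarith [sq_nonneg (F η - F (update η x s)), abs_nonneg δ, neg_abs_le δ, sq_nonneg ε, sq_nonneg M]
    · nlinarith [le_abs_self δ, sq_nonneg ε]
  have hint : Integrable (fun s => (F η - F (update η x s)) ^ 2 + (4 * δ * ε + 4 * ε ^ 2)) (siteLaw γ x η) :=
    Integrable.of_bound ((((measurable_const.sub (hF.comp (measurable_update η))).pow_const 2).add measurable_const).aestronglyMeasurable)
      ((2 * M) ^ 2 + (4 * |δ| * ε + 4 * ε ^ 2)) (ae_of_all _ fun s => by rw [Real.norm_eq_abs]; exact hFb2 s)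
  have hmono := integral_mono_of_nonneg (μ := siteLaw γ x η) (ae_of_all _ fun s => sq_nonneg (G η - G (update η x s))) hint (ae_of_all _ hpt)
  refine hmono.trans (le_of_eq ?_)
  rw [integral_add ?_ (integrable_const _)]
  · simp
  · exact Integrable.of_bound (((measurable_const.sub (hF.comp (measurable_update η))).pow_const 2).aestronglyMeasurable) ((2 * M) ^ 2)
      (ae_of_all _ fun s => by
        rw [Real.norm_eq_abs, abs_pow, sq_abs, ← sq_abs]
        exact pow_le_pow_left₀ (abs_nonneg _) ((abs_sub _ _).trans (by linarith [hM η, hM (update η x s)])) 2)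

/-- **State step**: integrating the kernel step against a probability measure `μ`:
`∫∫ (G(U) − G(σ))² γ_{x}(dσ|U) μ(dU) ≤ ∫∫ (F(U) − F(σ))² γ_{x}(dσ|U) μ(dU) + (4δε + 4ε²)`. [folklore] -/
theorem integral_integral_sq_sub_le_add_of_approx (hγ : IsSpecification γ) {μ : Measure (ι → S)} [IsProbabilityMeasure μ] (x : ι)
    {F G : (ι → S) → ℝ} (hF : Measurable F) (hG : Measurable G) {M ε δ : ℝ} (hM : ∀ U, |F U| ≤ M) (hε : ∀ U, |G U - F U| ≤ ε)
    (hδ : ∀ U s, |F U - F (update U x s)| ≤ δ) :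
    ∫ U, ∫ σ, (G U - G σ) ^ 2 ∂(γ {x} U) ∂μ ≤ ∫ U, ∫ σ, (F U - F σ) ^ 2 ∂(γ {x} U) ∂μ + (4 * δ * ε + 4 * ε ^ 2) := by
  have hint : Integrable (fun U => ∫ σ, (F U - F σ) ^ 2 ∂(γ {x} U) + (4 * δ * ε + 4 * ε ^ 2)) μ :=
    (integrable_of_abs_le' (measurable_integral_sq_sub hγ x hF hM) (M := 4 * M ^ 2) (abs_integral_sq_sub_le hγ x hM)).add (integrable_const _)
  have hmono := integral_mono_of_nonneg (μ := μ) (ae_of_all _ fun U => integral_nonneg fun σ => sq_nonneg (G U - G σ)) hint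
    (ae_of_all _ fun U => integral_sq_sub_le_add_of_approx hγ x hF hG hM hε hδ U)
  refine hmono.trans (le_of_eq ?_)
  rw [integral_add (integrable_of_abs_le' (measurable_integral_sq_sub hγ x hF hM) (M := 4 * M ^ 2) (abs_integral_sq_sub_le hγ x hM)) (integrable_const _)]
  simp

omit [DecidableEq ι] in
/-- **Variance step**: if `|G − F| ≤ ε` uniformly, `|F| ≤ M`, then `Var_μ(F) ≤ Var_μ(G) + (8(M + ε)ε + 4ε²)` for a probability measure `μ`. [folklore] -/
theorem variance_le_variance_add_of_approx {μ : Measure (ι → S)} [IsProbabilityMeasure μ] {F G : (ι → S) → ℝ} (hF : Measurable F)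
    (hG : Measurable G) {M ε : ℝ} (hM : ∀ U, |F U| ≤ M) (hε : ∀ U, |G U - F U| ≤ ε) :
    variance F μ ≤ variance G μ + (8 * (M + ε) * ε + 4 * ε ^ 2) := by
  have hne : Nonempty (ι → S) := by
    by_contra hc
    rw [not_nonempty_iff] at hc
    have h1 := measure_univ (μ := μ)
    rw [Set.univ_eq_empty_iff.mpr hc, measure_empty] at h1
    exact zero_ne_one h1
  have hε0 : 0 ≤ ε := (abs_nonneg _).trans (hε (Classical.arbitrary _))
  have hMG : ∀ U, |G U| ≤ M + ε := fun U => by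
    have h1 : G U = F U + (G U - F U) := by ring
    rw [h1]
    exact (abs_add_le (F U) (G U - F U)).trans (add_le_add (hM U) (hε U))
  have hiF : Integrable F μ := integrable_of_abs_le' hF hM
  have hiG : Integrable G μ := integrable_of_abs_le' hG hMG
  rw [variance_eq_integral hF.aemeasurable, variance_eq_integral hG.aemeasurable]
  set mF := ∫ U, F U ∂μ with hmF
  set mG := ∫ U, G U ∂μ with hmG
  have hmFG : |mG - mF| ≤ ε := by
    rw [hmF, hmG, ← integral_sub hiG hiF]
    have h := norm_integral_le_of_norm_le_const (μ := μ) (f := fun U => G U - F U) (C := ε) (ae_of_all _ fun U => by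
      rw [Real.norm_eq_abs]; exact hε U)
    simpa using h
  have hmGb : |mG| ≤ M + ε := by
    have h := norm_integral_le_of_norm_le_const (μ := μ) (f := G) (C := M + ε) (ae_of_all _ fun U => by rw [Real.norm_eq_abs]; exact hMG U)
    simpa using h
  -- pointwise: (F − mF)² ≤ (G − mG)² + 8(M+ε)ε + 4ε²
  have hpt : ∀ U, (F U - mF) ^ 2 ≤ (G U - mG) ^ 2 + (8 * (M + ε) * ε + 4 * ε ^ 2) := fun U => by
    have hr : |(F U - mF) - (G U - mG)| ≤ 2 * ε := by
      have e : (F U - mF) - (G U - mG) = (mG - mF) - (G U - F U) := by ring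
      rw [e]; exact (abs_sub _ _).trans (by linarith [hε U])
    have hDG : |G U - mG| ≤ 2 * (M + ε) := (abs_sub _ _).trans (by linarith [hMG U])
    have h := sq_le_sq_add_of_abs_sub_le hDG hr
    have e : 4 * (2 * (M + ε)) * ε + 4 * ε ^ 2 = 8 * (M + ε) * ε + 4 * ε ^ 2 := by ring
    rw [e] at h
    exact h
  have hint : Integrable (fun U => (G U - mG) ^ 2 + (8 * (M + ε) * ε + 4 * ε ^ 2)) μ := by
    refine (Integrable.of_bound (((hG.sub measurable_const).pow_const 2).aestronglyMeasurable) ((2 * (M + ε)) ^ 2)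
      (ae_of_all _ fun U => ?_)).add (integrable_const _)
    rw [Real.norm_eq_abs, abs_pow, sq_abs, ← sq_abs]
    exact pow_le_pow_left₀ (abs_nonneg _) ((abs_sub _ _).trans (by linarith [hMG U])) 2
  have hmono := integral_mono_of_nonneg (μ := μ) (ae_of_all _ fun U => sq_nonneg (F U - mF)) hint (ae_of_all _ hpt)
  refine hmono.trans (le_of_eq ?_)
  rw [integral_add ?_ (integrable_const _)]
  · simp
  · refine Integrable.of_bound (((hG.sub measurable_const).pow_const 2).aestronglyMeasurable) ((2 * (M + ε)) ^ 2) (ae_of_all _ fun U => ?_)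
    rw [Real.norm_eq_abs, abs_pow, sq_abs, ← sq_abs]
    exact pow_le_pow_left₀ (abs_nonneg _) ((abs_sub _ _).trans (by linarith [hMG U])) 2

/-- ★★ **CLOSURE OF A GIBBS-STATE HEAT-BATH POINCARÉ INEQUALITY UNDER UNIFORM APPROXIMATION.**  Let `μ` be a Gibbs state of the specification `γ`,
`A ≥ 0`, `F` bounded measurable with one-link oscillations `|F(U) − F(U[x ↦ s])| ≤ δ_x`, `∑_x δ_x² < ∞`, and `G_n` measurable observables with the SAME
oscillation profile, `|G_n − F| ≤ ε_n → 0` uniformly, each satisfying the Poincaré inequality `Var_μ(G_n) ≤ A ∑_{x ∈ Δ_n} ∫∫ (G_n(U) − G_n(σ))² γ_{x}(dσ|U) μ(dU)`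
on some finite link set `Δ_n`.  Then `Var_μ(F) ≤ A ∑'_x ∫∫ (F(U) − F(σ))² γ_{x}(dσ|U) μ(dU)` (the series converges: its terms are `≤ δ_x²`). [folklore] -/
theorem gibbs_variance_le_tsum_of_uniformApprox (hγ : IsSpecification γ) {μ : Measure (ι → S)} (hμ : IsGibbsMeasure γ μ) {A : ℝ} (hA : 0 ≤ A)
    {F : (ι → S) → ℝ} (hF : Measurable F) {M : ℝ} (hM : ∀ U, |F U| ≤ M)
    (δ : ι → ℝ) (hδ : ∀ x U s, |F U - F (update U x s)| ≤ δ x) (hδsum : Summable fun x => δ x ^ 2)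
    (G : ℕ → (ι → S) → ℝ) (hG : ∀ n, Measurable (G n)) (hGδ : ∀ n x U s, |G n U - G n (update U x s)| ≤ δ x)
    (ε : ℕ → ℝ) (hε : Tendsto ε atTop (𝓝 0)) (happrox : ∀ n U, |G n U - F U| ≤ ε n) (Δ : ℕ → Finset ι)
    (hP : ∀ n, variance (G n) μ ≤ A * ∑ x ∈ Δ n, ∫ U, ∫ σ, (G n U - G n σ) ^ 2 ∂(γ {x} U) ∂μ) :
    variance F μ ≤ A * ∑' x, ∫ U, ∫ σ, (F U - F σ) ^ 2 ∂(γ {x} U) ∂μ := by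
  haveI := hμ.isProbabilityMeasure
  have hne : Nonempty (ι → S) := by
    by_contra hc
    rw [not_nonempty_iff] at hc
    have h1 := measure_univ (μ := μ)
    rw [Set.univ_eq_empty_iff.mpr hc, measure_empty] at h1
    exact zero_ne_one h1
  obtain ⟨U₀⟩ := hne
  have hδ0 : ∀ x, 0 ≤ δ x := fun x => (abs_nonneg _).trans (hδ x U₀ (U₀ x))
  have hε0 : ∀ n, 0 ≤ ε n := fun n => (abs_nonneg _).trans (happrox n U₀)
  -- the conditional-variance functionals
  set T : ι → ℝ := fun x => ∫ U, ∫ σ, (F U - F σ) ^ 2 ∂(γ {x} U) ∂μ with hT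
  have hT0 : ∀ x, 0 ≤ T x := fun x => integral_nonneg fun U => integral_nonneg fun σ => sq_nonneg _
  have hTle : ∀ x, T x ≤ δ x ^ 2 := fun x => by
    have h := integral_mono_of_nonneg (μ := μ) (ae_of_all _ fun U => integral_nonneg fun σ => sq_nonneg (F U - F σ))
      (integrable_const (δ x ^ 2)) (ae_of_all _ fun U => integral_sq_sub_le_sq hγ x hF U (hδ x U))
    simpa using h
  have hTsum : Summable T := Summable.of_nonneg_of_le hT0 hTle hδsum
  -- the dominating comparison sequence
  set φ : ℕ → ι → ℝ := fun n x => min (δ x ^ 2) (T x + (4 * δ x * ε n + 4 * ε n ^ 2)) with hφ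
  have hφ0 : ∀ n x, 0 ≤ φ n x := fun n x => le_min (sq_nonneg _) (by nlinarith [hT0 x, hδ0 x, hε0 n])
  have hφle : ∀ n x, φ n x ≤ δ x ^ 2 := fun n x => min_le_left _ _
  have hφsum : ∀ n, Summable (φ n) := fun n => Summable.of_nonneg_of_le (hφ0 n) (hφle n) hδsum
  -- for every `n`: `Var F ≤ A ∑' φ_n + a_n`
  have hstep : ∀ n, variance F μ ≤ A * ∑' x, φ n x + (8 * (M + ε n) * ε n + 4 * ε n ^ 2) := by
    intro n
    have hTn : ∀ x, ∫ U, ∫ σ, (G n U - G n σ) ^ 2 ∂(γ {x} U) ∂μ ≤ φ n x := fun x => by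
      refine le_min ?_ (integral_integral_sq_sub_le_add_of_approx hγ x hF (hG n) hM (happrox n) (hδ x))
      have h := integral_mono_of_nonneg (μ := μ) (ae_of_all _ fun U => integral_nonneg fun σ => sq_nonneg (G n U - G n σ))
        (integrable_const (δ x ^ 2)) (ae_of_all _ fun U => integral_sq_sub_le_sq hγ x (hG n) U (hGδ n x U))
      simpa using h
    have hsum_le : ∑ x ∈ Δ n, ∫ U, ∫ σ, (G n U - G n σ) ^ 2 ∂(γ {x} U) ∂μ ≤ ∑' x, φ n x :=
      (Finset.sum_le_sum fun x _ => hTn x).trans ((hφsum n).sum_le_tsum (Δ n) fun x _ => hφ0 n x)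
    calc variance F μ ≤ variance (G n) μ + (8 * (M + ε n) * ε n + 4 * ε n ^ 2) :=
          variance_le_variance_add_of_approx hF (hG n) hM (happrox n)
      _ ≤ A * ∑' x, φ n x + (8 * (M + ε n) * ε n + 4 * ε n ^ 2) := by
          have := (hP n).trans (mul_le_mul_of_nonneg_left hsum_le hA); linarith
  -- the limit `n → ∞`
  have hlimφ : Tendsto (fun n => ∑' x, φ n x) atTop (𝓝 (∑' x, T x)) := by
    refine tendsto_tsum_of_dominated_convergence (bound := fun x => δ x ^ 2) hδsum (fun x => ?_) ?_
    · have h1 : Tendsto (fun n => min (δ x ^ 2) (T x + (4 * δ x * ε n + 4 * ε n ^ 2))) atTop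
          (𝓝 (min (δ x ^ 2) (T x + (4 * δ x * 0 + 4 * (0 : ℝ) ^ 2)))) :=
        tendsto_const_nhds.min (tendsto_const_nhds.add ((tendsto_const_nhds.mul hε).add ((hε.pow 2).const_mul 4)))
      rw [mul_zero, zero_pow two_ne_zero, mul_zero, add_zero, add_zero, min_eq_right (hTle x)] at h1
      exact h1
    · exact Eventually.of_forall fun n x => by rw [Real.norm_eq_abs, abs_of_nonneg (hφ0 n x)]; exact hφle n x
  have hlima : Tendsto (fun n => 8 * (M + ε n) * ε n + 4 * ε n ^ 2) atTop (𝓝 0) := by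
    have h : Tendsto (fun n => 8 * (M + ε n) * ε n + 4 * ε n ^ 2) atTop (𝓝 (8 * (M + 0) * 0 + 4 * (0 : ℝ) ^ 2)) :=
      ((((tendsto_const_nhds (x := M)).add hε).const_mul 8).mul hε).add ((hε.pow 2).const_mul 4)
    rw [mul_zero, zero_pow two_ne_zero, mul_zero, add_zero] at h
    exact h
  have hlim : Tendsto (fun n => A * ∑' x, φ n x + (8 * (M + ε n) * ε n + 4 * ε n ^ 2)) atTop (𝓝 (A * ∑' x, T x + 0)) :=
    (hlimφ.const_mul A).add hlima
  rw [add_zero] at hlim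
  exact ge_of_tendsto' hlim hstep

end Abstract

/-! ### Wilson cells: every `SU(N)` on the KR window, and `SU(2)`, `d = 4`, `0 ≤ β_W < 2/9` -/

section Wilson

variable {d N : ℕ}

/-- ★★ **THE HEAT-BATH POINCARÉ INEQUALITY OF EVERY GIBBS STATE ON ITS NATURAL DOMAIN** (`SU(N)`, 't Hooft `β`, bare `Nβ`; `OneLinkKRModulus N R K` on
`R ≥ 2(d−1)|β|`, `6(d−1)|β|K ≤ c < 1`): for EVERY DLR state `μ` of the Wilson specification and every bounded measurable observable `F` that is a
UNIFORM LIMIT of Lipschitz cylinders `G_n` (`|G_n − F| ≤ ε_n → 0`) sharing `F`'s one-link oscillation profile `δ` with `∑_x δ_x² < ∞`,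
`Var_μ(F) ≤ (2(1−c))⁻¹ ∑'_{x} ∫∫ (F(U) − F(σ))² γ_{x}(dσ|U) μ(dU)` — the `ℓ²(links)` Dirichlet sum over ALL links of `ℤ^d`. [folklore] -/
theorem gibbsVariance_le_tsum_of_oneLinkKRModulus (hd : 1 ≤ d) (hN : 1 ≤ N) {β R K c : ℝ} (hK : 0 ≤ K)
    (hR : |β| * (2 * ((d : ℝ) - 1)) ≤ R) (hmod : OneLinkKRModulus N R K) (hc : 6 * ((d : ℝ) - 1) * |β| * K ≤ c) (hc1 : c < 1)
    {μ : Measure (LGConfig d (Matrix.specialUnitaryGroup (Fin N) ℂ))}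
    (hμ : μ ∈ ymGibbsMeasures (d := d) (fundamentalRep (Fin N)) (N * β))
    {F : LGConfig d (Matrix.specialUnitaryGroup (Fin N) ℂ) → ℝ} (hF : Measurable F) {M : ℝ} (hM : ∀ U, |F U| ≤ M)
    (δ : ZdEdge d → ℝ) (hδ : ∀ x U s, |F U - F (update U x s)| ≤ δ x) (hδsum : Summable fun x => δ x ^ 2)
    (G : ℕ → LGConfig d (Matrix.specialUnitaryGroup (Fin N) ℂ) → ℝ) (Δ : ℕ → Finset (ZdEdge d)) (KG : ℕ → ℝ≥0)
    (hGcyl : ∀ n, IsLipschitzCylinder (fundamentalRep (Fin N)) (G n) (Δ n) (KG n))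
    (hGδ : ∀ n x U s, |G n U - G n (update U x s)| ≤ δ x)
    (ε : ℕ → ℝ) (hε : Tendsto ε atTop (𝓝 0)) (happrox : ∀ n U, |G n U - F U| ≤ ε n) :
    ProbabilityTheory.variance F μ ≤
      (2 * (1 - c))⁻¹ * ∑' x, ∫ U, ∫ σ, (F U - F σ) ^ 2 ∂(ymSpecification (fundamentalRep (Fin N)) (N * β) {x} U) ∂μ := by
  classical
  haveI : SecondCountableTopology (Matrix (Fin N) (Fin N) ℂ) :=
    inferInstanceAs (SecondCountableTopology (Fin N → Fin N → ℂ))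
  haveI : SecondCountableTopology (Matrix.specialUnitaryGroup (Fin N) ℂ) :=
    Topology.IsEmbedding.subtypeVal.secondCountableTopology
  have hγ : IsSpecification (ymSpecification (d := d) (fundamentalRep (Fin N)) (N * β)) :=
    isSpecification_ymSpecification_of_t2Space _ (continuous_fundamentalRep (Fin N)) _
  have hμ' : IsGibbsMeasure (ymSpecification (d := d) (fundamentalRep (Fin N)) (N * β)) μ := hμ
  have hlt : 0 < 2 * (1 - c) := by linarith
  exact gibbs_variance_le_tsum_of_uniformApprox hγ hμ' (A := (2 * (1 - c))⁻¹) (inv_nonneg.2 hlt.le) hF hM δ hδ hδsum G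
    (fun n => (hGcyl n).measurable) hGδ ε hε happrox Δ fun n => gibbsVariance_le_of_oneLinkKRModulus hd hN hK hR hmod hc hc1 hμ (hGcyl n)

/-- ★★ **`SU(2)`, `d = 4`, HYPOTHESIS-FREE on `0 ≤ β_W < 2/9`** (tree coupling `β_W/2`): for EVERY DLR state `μ` of 4D `SU(2)` lattice Yang–Mills and every
bounded measurable `F` that is a uniform limit of Lipschitz cylinders sharing its square-summable one-link oscillation profile `δ`,
`Var_μ(F) ≤ (2 − 9β_W)⁻¹ ∑'_{x} ∫∫ (F(U) − F(σ))² γ_{x}(dσ|U) μ(dU)`. [folklore] -/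
theorem su2_gibbsVariance_le_tsum {βW : ℝ} (h0 : 0 ≤ βW) (h : βW < 2 / 9)
    {μ : Measure (LGConfig 4 (Matrix.specialUnitaryGroup (Fin 2) ℂ))}
    (hμ : μ ∈ ymGibbsMeasures (d := 4) (fundamentalRep (Fin 2)) (βW / 2))
    {F : LGConfig 4 (Matrix.specialUnitaryGroup (Fin 2) ℂ) → ℝ} (hF : Measurable F) {M : ℝ} (hM : ∀ U, |F U| ≤ M)
    (δ : ZdEdge 4 → ℝ) (hδ : ∀ x U s, |F U - F (update U x s)| ≤ δ x) (hδsum : Summable fun x => δ x ^ 2)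
    (G : ℕ → LGConfig 4 (Matrix.specialUnitaryGroup (Fin 2) ℂ) → ℝ) (Δ : ℕ → Finset (ZdEdge 4)) (KG : ℕ → ℝ≥0)
    (hGcyl : ∀ n, IsLipschitzCylinder (fundamentalRep (Fin 2)) (G n) (Δ n) (KG n))
    (hGδ : ∀ n x U s, |G n U - G n (update U x s)| ≤ δ x)
    (ε : ℕ → ℝ) (hε : Tendsto ε atTop (𝓝 0)) (happrox : ∀ n U, |G n U - F U| ≤ ε n) :
    ProbabilityTheory.variance F μ ≤
      (2 - 9 * βW)⁻¹ * ∑' x, ∫ U, ∫ σ, (F U - F σ) ^ 2 ∂(ymSpecification (fundamentalRep (Fin 2)) (βW / 2) {x} U) ∂μ := by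
  have hβ : ((2 : ℕ) : ℝ) * (βW / 4) = βW / 2 := by push_cast; ring
  have habs : |βW / 4| = βW / 4 := abs_of_nonneg (by positivity)
  have hμ4 : μ ∈ ymGibbsMeasures (d := 4) (fundamentalRep (Fin 2)) ((2 : ℕ) * (βW / 4)) := by rwa [hβ]
  have key := gibbsVariance_le_tsum_of_oneLinkKRModulus (d := 4) (N := 2) (by norm_num) (by norm_num) (β := βW / 4) (R := 3 * βW / 2)
    zero_le_one (by rw [habs]; norm_num; linarith) (SlabAreaLawDimensions.su2_oneLinkKRModulus_of_le_one (by linarith)) (c := 9 * βW / 2)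
    (by rw [habs]; norm_num; linarith) (by linarith) hμ4 hF hM δ hδ hδsum G Δ KG hGcyl hGδ ε hε happrox
  have e : (2 * (1 - 9 * βW / 2))⁻¹ = (2 - 9 * βW)⁻¹ := by congr 1; ring
  rw [e, hβ] at key
  exact key

end Wilson

/-! ### Ball cells: every member of the `ℤ^d` ball, and the `SU(2)` quarter cell -/

section Ball

variable {d N : ℕ}

/-- ★★ **THE SAME ON THE `ℤ^d` BALL**: under the hypotheses of `HeatBathPoincareZd.gibbsVariance_le_onBall` (member `W` with loads `(a, ℓ_s, Λ, Λc)`, range `R`,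
column condition `6(d−1)|β|K e^{a}(1 + 2√N ℓ_s) + √N Λc ≤ c < 1`, row condition `… + √N Λ < 1`), EVERY DLR state `μ ∈ 𝒢(γ^W)` and every bounded measurable `F`
that is a uniform limit of Lipschitz cylinders sharing its square-summable one-link oscillation profile satisfy
`Var_μ(F) ≤ (2(1−c))⁻¹ ∑'_x ∫∫ (F(U) − F(σ))² γ^W_{x}(dσ|U) μ(dU)` — ONE constant for the ball, on the natural domain. [folklore] -/
theorem gibbsVariance_le_tsum_onBall (hd : 1 ≤ d) (hN : 1 ≤ N) {β b K a ℓs Λ Λc R c : ℝ} (hK : 0 ≤ K) (hℓs : 0 ≤ ℓs)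
    (hb : |β| * (2 * ((d : ℝ) - 1)) ≤ b) (hmod : OneLinkKRModulus N b K)
    {W : Potential (ZdEdge d) (Matrix.specialUnitaryGroup (Fin N) ℂ)} (hWc : ∀ X, Continuous (W X))
    (hWdep : ∀ X, DependsOn (W X) (↑X : Set (ZdEdge d)))
    {supp : Finset (ZdEdge d) → Finset (Finset (ZdEdge d))} (hsupp : W.IsSupportedBy supp)
    {osc : Finset (ZdEdge d) → ZdEdge d → ℝ} (hosc : ∀ X, Dobrushin.IsOscBound (W X) (osc X))
    (hosca : ∀ e, ∑ X ∈ (supp {e}).filter (fun X => e ∈ X), osc X e ≤ a)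
    {lip : Finset (ZdEdge d) → ZdEdge d → ℝ} (hlip : ∀ X, IsLipBound suFrobDist (W X) (lip X))
    (hlips : ∀ e, ∑ X ∈ (supp {e}).filter (fun X => e ∈ X), lip X e ≤ ℓs)
    (hΛ : ∀ e, ∑ y ∈ perturbedNbr supp e, ∑ X ∈ (supp {e}).filter (fun X => e ∈ X), lip X y ≤ Λ)
    (hcol : ∀ (y : ZdEdge d) (T : Finset (ZdEdge d)), y ∉ T → ∑ e ∈ T, ∑ X ∈ (supp {e}).filter (fun X => e ∈ X), lip X y ≤ Λc)
    (hR : ∀ e, ∀ X ∈ supp {e}, e ∈ X → ∀ y ∈ X, ‖e.1 - y.1‖ ≤ R)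
    (hc : 6 * ((d : ℝ) - 1) * |β| * (K * Real.exp a * (1 + 2 * Real.sqrt N * ℓs)) + Real.sqrt N * Λc ≤ c) (hc1 : c < 1)
    (hrow : 6 * ((d : ℝ) - 1) * |β| * (K * Real.exp a * (1 + 2 * Real.sqrt N * ℓs)) + Real.sqrt N * Λ < 1)
    {μ : Measure (LGConfig d (Matrix.specialUnitaryGroup (Fin N) ℂ))}
    (hμ : μ ∈ perturbedGibbsMeasures (d := d) (fundamentalRep (Fin N)) (N * β) W supp)
    {F : LGConfig d (Matrix.specialUnitaryGroup (Fin N) ℂ) → ℝ} (hF : Measurable F) {M : ℝ} (hM : ∀ U, |F U| ≤ M)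
    (δ : ZdEdge d → ℝ) (hδ : ∀ x U s, |F U - F (update U x s)| ≤ δ x) (hδsum : Summable fun x => δ x ^ 2)
    (G : ℕ → LGConfig d (Matrix.specialUnitaryGroup (Fin N) ℂ) → ℝ) (Δ : ℕ → Finset (ZdEdge d)) (KG : ℕ → ℝ≥0)
    (hGcyl : ∀ n, IsLipschitzCylinder (fundamentalRep (Fin N)) (G n) (Δ n) (KG n))
    (hGδ : ∀ n x U s, |G n U - G n (update U x s)| ≤ δ x)
    (ε : ℕ → ℝ) (hε : Tendsto ε atTop (𝓝 0)) (happrox : ∀ n U, |G n U - F U| ≤ ε n) :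
    ProbabilityTheory.variance F μ ≤
      (2 * (1 - c))⁻¹ * ∑' x, ∫ U, ∫ σ, (F U - F σ) ^ 2 ∂(perturbedYM (fundamentalRep (Fin N)) (N * β) W supp {x} U) ∂μ := by
  classical
  haveI : SecondCountableTopology (Matrix (Fin N) (Fin N) ℂ) :=
    inferInstanceAs (SecondCountableTopology (Fin N → Fin N → ℂ))
  haveI : SecondCountableTopology (Matrix.specialUnitaryGroup (Fin N) ℂ) :=
    Topology.IsEmbedding.subtypeVal.secondCountableTopology
  have hρc := continuous_fundamentalRep (Fin N)
  have hW : W.IsAdapted := fun X => ⟨hWdep X, (hWc X).measurable⟩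
  have hWb : ∀ X, ∃ C, ∀ U, |W X U| ≤ C := fun X => exists_bound_of_continuous (hWc X)
  have hγ : IsSpecification (perturbedYM (d := d) (fundamentalRep (Fin N)) (N * β) W supp) := isSpecification_perturbedYM _ hρc _ hW hWb hsupp
  have hμ' : IsGibbsMeasure (perturbedYM (d := d) (fundamentalRep (Fin N)) (N * β) W supp) μ := hμ
  have hlt : 0 < 2 * (1 - c) := by linarith
  exact gibbs_variance_le_tsum_of_uniformApprox hγ hμ' (A := (2 * (1 - c))⁻¹) (inv_nonneg.2 hlt.le) hF hM δ hδ hδsum G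
    (fun n => (hGcyl n).measurable) hGδ ε hε happrox Δ fun n =>
      gibbsVariance_le_onBall hd hN hK hℓs hb hmod hWc hWdep hsupp hosc hosca hlip hlips hΛ hcol hR hc hc1 hrow hμ (hGcyl n)

/-- ★ **`SU(2)`, every `d`, quarter modulus** (tree coupling `β_W/2`, `(d−1)β_W/2 ≤ 1`): for a member with column condition
`(3/2)(d−1)β_W e^{a}(1 + 2√2 ℓ_s) + √2 Λc ≤ c < 1` and row condition `(3/2)(d−1)β_W e^{a}(1 + 2√2 ℓ_s) + √2 Λ < 1`, EVERY DLR state of the member and every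
`F` of the closure class satisfy `Var_μ(F) ≤ (2(1−c))⁻¹ ∑'_x ∫∫ (F(U) − F(σ))² γ^W_{x}(dσ|U) μ(dU)`. [folklore] -/
theorem su2_gibbsVariance_le_tsum_onBall_quarter (hd : 1 ≤ d) {βW a ℓs Λ Λc R c : ℝ} (h0 : 0 ≤ βW) (hβ : ((d : ℝ) - 1) * βW / 2 ≤ 1)
    (hℓs : 0 ≤ ℓs) {W : Potential (ZdEdge d) (Matrix.specialUnitaryGroup (Fin 2) ℂ)} (hWc : ∀ X, Continuous (W X))
    (hWdep : ∀ X, DependsOn (W X) (↑X : Set (ZdEdge d)))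
    {supp : Finset (ZdEdge d) → Finset (Finset (ZdEdge d))} (hsupp : W.IsSupportedBy supp)
    {osc : Finset (ZdEdge d) → ZdEdge d → ℝ} (hosc : ∀ X, Dobrushin.IsOscBound (W X) (osc X))
    (hosca : ∀ e, ∑ X ∈ (supp {e}).filter (fun X => e ∈ X), osc X e ≤ a)
    {lip : Finset (ZdEdge d) → ZdEdge d → ℝ} (hlip : ∀ X, IsLipBound suFrobDist (W X) (lip X))
    (hlips : ∀ e, ∑ X ∈ (supp {e}).filter (fun X => e ∈ X), lip X e ≤ ℓs)
    (hΛ : ∀ e, ∑ y ∈ perturbedNbr supp e, ∑ X ∈ (supp {e}).filter (fun X => e ∈ X), lip X y ≤ Λ)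
    (hcol : ∀ (y : ZdEdge d) (T : Finset (ZdEdge d)), y ∉ T → ∑ e ∈ T, ∑ X ∈ (supp {e}).filter (fun X => e ∈ X), lip X y ≤ Λc)
    (hR : ∀ e, ∀ X ∈ supp {e}, e ∈ X → ∀ y ∈ X, ‖e.1 - y.1‖ ≤ R)
    (hc : 3 / 2 * ((d : ℝ) - 1) * βW * (Real.exp a * (1 + 2 * Real.sqrt 2 * ℓs)) + Real.sqrt 2 * Λc ≤ c) (hc1 : c < 1)
    (hrow : 3 / 2 * ((d : ℝ) - 1) * βW * (Real.exp a * (1 + 2 * Real.sqrt 2 * ℓs)) + Real.sqrt 2 * Λ < 1)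
    {μ : Measure (LGConfig d (Matrix.specialUnitaryGroup (Fin 2) ℂ))}
    (hμ : μ ∈ perturbedGibbsMeasures (d := d) (fundamentalRep (Fin 2)) (βW / 2) W supp)
    {F : LGConfig d (Matrix.specialUnitaryGroup (Fin 2) ℂ) → ℝ} (hF : Measurable F) {M : ℝ} (hM : ∀ U, |F U| ≤ M)
    (δ : ZdEdge d → ℝ) (hδ : ∀ x U s, |F U - F (update U x s)| ≤ δ x) (hδsum : Summable fun x => δ x ^ 2)
    (G : ℕ → LGConfig d (Matrix.specialUnitaryGroup (Fin 2) ℂ) → ℝ) (Δ : ℕ → Finset (ZdEdge d)) (KG : ℕ → ℝ≥0)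
    (hGcyl : ∀ n, IsLipschitzCylinder (fundamentalRep (Fin 2)) (G n) (Δ n) (KG n))
    (hGδ : ∀ n x U s, |G n U - G n (update U x s)| ≤ δ x)
    (ε : ℕ → ℝ) (hε : Tendsto ε atTop (𝓝 0)) (happrox : ∀ n U, |G n U - F U| ≤ ε n) :
    ProbabilityTheory.variance F μ ≤
      (2 * (1 - c))⁻¹ * ∑' x, ∫ U, ∫ σ, (F U - F σ) ^ 2 ∂(perturbedYM (fundamentalRep (Fin 2)) (βW / 2) W supp {x} U) ∂μ := by
  have hdd : (0 : ℝ) ≤ (d : ℝ) - 1 := by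
    have : (1 : ℝ) ≤ d := by exact_mod_cast hd
    linarith
  have habs : |βW / 4| = βW / 4 := abs_of_nonneg (by positivity)
  have hβ' : ((2 : ℕ) : ℝ) * (βW / 4) = βW / 2 := by push_cast; ring
  have hμ4 : μ ∈ perturbedGibbsMeasures (d := d) (fundamentalRep (Fin 2)) ((2 : ℕ) * (βW / 4)) W supp := by rwa [hβ']
  have key := gibbsVariance_le_tsum_onBall (N := 2) hd (by norm_num) (β := βW / 4) zero_le_one hℓs (b := ((d : ℝ) - 1) * βW / 2)
    (by rw [habs]; nlinarith) (SlabAreaLawDimensions.su2_oneLinkKRModulus_of_le_one hβ) hWc hWdep hsupp hosc hosca hlip hlips hΛ hcol hR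
    (c := c) (by rw [habs]; push_cast; nlinarith [hc]) hc1 (by rw [habs]; push_cast; nlinarith [hrow]) hμ4 hF hM δ hδ hδsum G Δ KG hGcyl hGδ
    ε hε happrox
  rw [hβ'] at key
  exact key

end Ball

end Summit.Ventures.YMGap.RobustBall.HeatBathPoincareZd

end
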